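import Literature.MathematicalPhysics.QuantumFieldTheory.Balaban1983to89.B9Thm33G0ProbeZeroAtPinsAdm
import Literature.MathematicalPhysics.QuantumFieldTheory.Balaban1983to89.B9CoReadingCoordsHolderAdm

/-!
# `Balaban1983to89.B9Thm33G0ProbeZeroAtCutPins` — T. Bałaban, *Propagators for lattice gauge theories in a background field*, Commun. Math. Phys. **99** (1985) 389–434
# [Balaban1985BackgroundPropagators], Theorem 3.3 for `G₀` read through (3.40): THE FIELD `Thm33G0DirX.pX0 β` IS A THEOREM AT THE `Adm`-CUT PIN CARRIER `holderProbesKA` —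
# `HasMaj 𝔠⁽⁰⁾ 𝔠_P^{(β−2)} (Φ^X_β(U) ∘ G₀) (CX′·e^{−δ₀d})` from the (3.42)₁,₂-type majorants of `G₀`, `∇_U G₀`, member-uniformly, NO far-pair residual

statement-level skeleton of published theorems with citation tags; proofs where landed; nothing here is a claim about the Yang–Mills mass gap

THE PRINT.  (3.40) p. 397 («sup_{x,x′:|x−x′|≦1}»), (3.42) p. 397, Theorem 3.3 p. 399, p. 422–423.

WHY THIS FILE (seat `pub-ymgap-dag-n06-w6`, WIDTH-209 piece 1 W-c, face `hX`).  `B9Thm33G0ProbeZeroAtPinsAdm.pX0_of_far` gives `pX0` at the UNCUT carrier `holderProbesK` modulo the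
displayed far-pair hypothesis `hfar`; at the cut carrier `holderProbesKA` (`B9CoReadingCoordsHolderAdm`) the pair probes VANISH off `Adm`, so the residual disappears:
★★★ `pX0_holderProbesKA` — for unitary-like bond variables, def-Y's transporter (`par = parBY i`), the pins `hlev ∕ hβ1`, an ℝ-linear `G₀` with `HasMajorant (blkBK bI) G₀ (B₀·len²·e^{−δ₀d})`
and `HasMajorantHom (blkBK bI) (blkBK bI) (∇_{U,μ} ∘ G₀) (B₀·len·e^{−δ₀d})` (every `μ`), and `β ≤ 1`:
`HasMaj (cNormR R₀ H₀ (blkBK bI) _ 0) (cNormR R₀ H₀ (blkPK bI) _ (β − 2)) ((holderProbesKA …).ΦX U β ∘ₗ G₀) ((CX + B₀ + coordBound·basisBound·B₀)·e^{−δ₀d})`,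
`CX = coordBound·(d+1)·basisBound·B₀·L·e^{δ₀((d+1)(L+1)+2)}` — the TYPE of `Thm33G0DirX.pX0 β` once `h𝔭A` reads `holderProbesKA` (and `hblk12`, `hG0co12`, `h𝔡Ad` as in ed. 27).
v1.1 (append-only): ★★★ `pX0_of_pins` — the same under the pin EQUATIONS (`h𝔭`, `hblk`, `hDd`) and any length-non-negativity proof `hlen` (the one-line consumable form).

HONEST SCOPE.  Assembly of landed pieces; the (3.42)-type majorants are displayed hypotheses (the certificate's derived `Thm33G0.e0 ∕ Thm33G0Dir.e1d`); nothing of [B9] asserted; the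
re-pin of `𝔭A` is the knit owner's decision; COUNT-NEUTRAL; N06 NOT discharged; one finite torus; nothing continuum, nothing about the mass gap.  Cell `pub-ymgap` (HUMAN RULING
D-0062), Track A node N06 [B9], seat `pub-ymgap-dag-n06-w6` (g0), 2026-08-28; a NEW file.
-/

namespace Literature.MathematicalPhysics.QuantumFieldTheory.Balaban1983to89.B9Thm33G0ProbeZeroAtCutPins

open B6GlobalChartV1 (PV blkV1)
open B6Ineq2142KLevelV1 (β lvl)
open B6KLevelCensusIndexV1 (KIdx Adm)
open B6Geom246MultiLevelTorus (geomT)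
open B6RandomWalk (BlockSupp HasMajorant)
open B6RandomWalkHom (HasMajorantHom)
open B9Thm34Ext (toB6)
open B9GeoNormsKLevelV1 (geo9K)
open B9Thm39ReadingCoords (coordBound39 basisBound39)
open B9CoReadingCoords (coordOpK XBK blkBK cdBₗ)
open B9CoReadingCoordsHolder (PK blkPK)
open B9CoReadingCoordsHolderAdm (holderProbesKA ΦX_KA_inl_of_adm ΦX_KA_inl_of_not_adm ΦX_KA_inr_inl ΦX_KA_inr_inr)
open B9Thm33G0ProbeZeroAtPinsAdm (pairProbe_G0_le_of_adm' pointProbe_G0_le transProbe_G0_le)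
open B9GeoLemma21KLevelV1 (geo9K_len_pos)
open Node00 (FBondY IBondY CfgY BondParY parBY)
open T4RelativeLadder (UnitaryLike)
open B9Thm312Whole (GeoOK)
open B9Thm312WholeClasses (cNormR hasMaj_cNormR_of_hasMajorantHom)
open B11SectG (HasMaj)

noncomputable section

variable {d ℓ : ℕ} {hd : 1 ≤ d + 1} {hL : Odd (ℓ + 1) ∧ 1 < ℓ + 1} {b₀ b₁ : ℝ}
variable {𝔸 : Type} [NormedRing 𝔸] [NormedAlgebra ℂ 𝔸] [CompleteSpace 𝔸]
variable {κ : Type} [Fintype κ]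
variable (i : KIdx d ℓ hd hL b₀ b₁) (b : Module.Basis κ ℝ 𝔸) [FiniteDimensional ℝ 𝔸] [Fintype (geo9K i).Site]

/-- ★★★ **`Thm33G0DirX.pX0 β` AT THE `Adm`-CUT PIN CARRIER — NO RESIDUAL**: see the module docstring.  Pair probes: at an admissible pair `ΦX_KA = ΦX_K` and
`pairProbe_G0_le_of_adm'`; at a non-admissible pair the cut probe is `0`; transported-point ∕ point probes: `transProbe_G0_le ∕ pointProbe_G0_le`; then n06-l's
`hasMaj_cNormR_of_hasMajorantHom`. [cite: Balaban1985BackgroundPropagators, (3.40) + (3.42) p.397, Thm 3.3 p.399, p.422–423] -/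
theorem pX0_holderProbesKA (hG : GeoOK (geo9K i)) {B : B9.Backgrounds} (cfg : B.Cfg → CfgY 𝔸 i) {par : BondParY 𝔸 i} (hpar : par = parBY i) (U₁ : B.Cfg)
    (hU : ∀ μ s, UnitaryLike (cfg U₁ μ s)) {bI : FBondY i → IBondY i}
    (hlev : ∀ x : FBondY i, lvl i.hN i.D i.hk (bI x) = (blkV1 i.hN i.D x).1.1)
    (hβ1 : ∀ x : FBondY i, (geomT i.D).dist (β i.hN i.D i.hk (bI x)) (blkV1 i.hN i.D x) ≤ 1)
    {R₀ : ℝ} {H₀ : Prop} (G0 : (XBK κ i → ℝ) →ₗ[ℝ] (XBK κ i → ℝ)) {B₀ δ₀ : ℝ} (hB₀ : 0 ≤ B₀) (hδ₀ : 0 ≤ δ₀)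
    (he0 : HasMajorant (g := toB6 (geo9K i) R₀ H₀) (blkBK i bI) G0 (fun a b' => B₀ * (geo9K i).len a ^ 2 * Real.exp (-(δ₀ * (geo9K i).dist a b'))))
    (he1d : ∀ μ : Fin (d + 1), HasMajorantHom (g := toB6 (geo9K i) R₀ H₀) (blkBK i bI) (blkBK i bI)
      (coordOpK b (fun _ : Fin (d + 1) => cdBₗ i (cfg U₁) μ) ∘ₗ G0) (fun a b' => B₀ * (geo9K i).len a * Real.exp (-(δ₀ * (geo9K i).dist a b'))))
    {βh : ℝ} (hβh : βh ≤ 1) :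
    HasMaj (cNormR R₀ H₀ (blkBK i bI) hG.lenle 0) (cNormR R₀ H₀ (blkPK bI) hG.lenle (βh - 2))
      ((holderProbesKA i b B cfg par bI).ΦX U₁ βh ∘ₗ G0)
      (fun a b' => (coordBound39 b * ((d : ℝ) + 1) * basisBound39 b * B₀ * ((ℓ : ℝ) + 1) * Real.exp (δ₀ * (((d : ℝ) + 1) * (((ℓ : ℝ) + 1) + 1) + 2)) +
        B₀ + coordBound39 b * basisBound39 b * B₀) * Real.exp (-(δ₀ * (geo9K i).dist a b'))) := by
  classical
  set CX : ℝ := coordBound39 b * ((d : ℝ) + 1) * basisBound39 b * B₀ * ((ℓ : ℝ) + 1) * Real.exp (δ₀ * (((d : ℝ) + 1) * (((ℓ : ℝ) + 1) + 1) + 2)) with hCX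
  set CT : ℝ := coordBound39 b * basisBound39 b * B₀ with hCT
  have hcB : 0 ≤ coordBound39 b := by unfold coordBound39; exact norm_nonneg _
  have hbB : 0 ≤ basisBound39 b := Finset.sum_nonneg fun _ _ => norm_nonneg _
  have hCX0 : 0 ≤ CX := by rw [hCX]; positivity
  have hCT0 : 0 ≤ CT := by rw [hCT]; positivity
  set Ctot : ℝ := CX + B₀ + CT with hCtot
  have hCtot0 : 0 ≤ Ctot := by rw [hCtot]; linarith
  have hhom : HasMajorantHom (g := toB6 (geo9K i) R₀ H₀) (blkBK i bI) (blkPK bI) ((holderProbesKA i b B cfg par bI).ΦX U₁ βh ∘ₗ G0)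
      (fun (a b' : (geo9K i).Site) => Ctot * Real.exp (-(δ₀ * (geo9K i).dist a b')) * (geo9K i).len a ^ (2 - βh) * (geo9K i).len b' ^ (0 : ℝ)) := by
    intro y' μv M hμ q
    have hM : 0 ≤ M := hμ.nonneg
    simp only [Real.rpow_zero, mul_one, LinearMap.comp_apply]
    have hup : ∀ {C a : ℝ} (y : IBondY i), 0 ≤ C → C ≤ Ctot →
        a ≤ C * (geo9K i).len y ^ (2 - βh) * Real.exp (-(δ₀ * (geo9K i).dist y y')) * M →
        a ≤ Ctot * Real.exp (-(δ₀ * (geo9K i).dist y y')) * (geo9K i).len y ^ (2 - βh) * M := by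
      intro C a y hC hCle h
      refine h.trans ?_
      have hl : 0 ≤ (geo9K i).len y ^ (2 - βh) := Real.rpow_nonneg (le_of_lt (geo9K_len_pos i y)) _
      have hE := Real.exp_nonneg (-(δ₀ * (geo9K i).dist y y'))
      calc C * (geo9K i).len y ^ (2 - βh) * Real.exp (-(δ₀ * (geo9K i).dist y y')) * M
          ≤ Ctot * (geo9K i).len y ^ (2 - βh) * Real.exp (-(δ₀ * (geo9K i).dist y y')) * M := by gcongr
        _ = Ctot * Real.exp (-(δ₀ * (geo9K i).dist y y')) * (geo9K i).len y ^ (2 - βh) * M := by ring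
    rcases q with ⟨⟨x, x'⟩, ν, c, c'⟩ | ⟨⟨x, x'⟩, ν, c, c'⟩ | ⟨x, ν, c, c'⟩
    · show |_| ≤ Ctot * Real.exp (-(δ₀ * (geo9K i).dist (bI x) y')) * (geo9K i).len (bI x) ^ (2 - βh) * M
      by_cases hadm : Adm i x x'
      · rw [ΦX_KA_inl_of_adm i b B cfg par U₁ βh (G0 μv) hadm ν c c']
        exact hup (bI x) hCX0 (by rw [hCtot]; linarith) (pairProbe_G0_le_of_adm' i b cfg hpar U₁ hU hlev hβ1 G0 hB₀ hδ₀ he1d hμ hadm hβh ν c c')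
      · rw [ΦX_KA_inl_of_not_adm i b B cfg par U₁ βh (G0 μv) hadm ν c c', abs_zero]
        have hl : 0 ≤ (geo9K i).len (bI x) ^ (2 - βh) := Real.rpow_nonneg (le_of_lt (geo9K_len_pos i (bI x))) _
        have hE := Real.exp_nonneg (-(δ₀ * (geo9K i).dist (bI x) y'))
        positivity
    · show |_| ≤ Ctot * Real.exp (-(δ₀ * (geo9K i).dist (bI x') y')) * (geo9K i).len (bI x') ^ (2 - βh) * M
      rw [ΦX_KA_inr_inl]
      exact hup (bI x') hCT0 (by rw [hCtot]; linarith) (transProbe_G0_le i b cfg hpar U₁ hU hlev G0 he0 hμ βh x x' ν c c')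
    · show |_| ≤ Ctot * Real.exp (-(δ₀ * (geo9K i).dist (bI x) y')) * (geo9K i).len (bI x) ^ (2 - βh) * M
      rw [ΦX_KA_inr_inr]
      exact hup (bI x) hB₀ (by rw [hCtot]; linarith) (pointProbe_G0_le i b cfg par U₁ hlev G0 he0 hμ βh x ν c c')
  have h' := hasMaj_cNormR_of_hasMajorantHom hG (C := fun a b' => Ctot * Real.exp (-(δ₀ * (geo9K i).dist a b')))
    (fun a b' => mul_nonneg hCtot0 (Real.exp_nonneg _)) (2 - βh) 0 hhom
  have e : -(2 - βh) = βh - 2 := by ring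
  rw [e] at h'
  exact h'

/-! ## v1.1 (append-only) — the same under the certificate's pin EQUATIONS, the shape an edition consumes in one line -/

/-- ★★★ **`pX0` UNDER THE PINS** (the `…_of_pins` form of `pX0_holderProbesKA`, like n06-d's `bond_h1ReadsNbr_of_pins`): for a probe letter `𝔭` pinned to the cut carrier
(`h𝔭 : 𝔭 = holderProbesKA …`), a block map `blk` pinned to `blkBK bI` (`hblk`), a direction-indexed derivative `Dd` pinned to the coordinate derivative (`hDd`, the certificate's
`h𝔡Ad` shape), the record's transporter (`hpar : par = parBY i`), unitary-like bond variables and ANY scale-length non-negativity proof `hlen`: from `HasMajorant blk G₀ (B₀·len²·e^{−δ₀d})`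
(`Thm33G0.e0`'s field) and `∀ μ, HasMajorantHom blk blk (Dd μ ∘ G₀) (B₀·len·e^{−δ₀d})` (`Thm33G0Dir.e1d`'s field) —
`HasMaj (cNormR R₀ H₀ blk hlen 0) (cNormR R₀ H₀ 𝔭.blkPX hlen (β−2)) (𝔭.ΦX U β ∘ₗ G₀) ((CX + B₀ + coordBound·basisBound·B₀)·e^{−δ₀d})` for `β ≤ 1`: the TYPE of the field
`Thm33G0DirX.pX0 β` of the certificate's binder `hX` at the letters `(𝔬12 x).blk ∕ (𝔬12 x).G0 U ∕ (𝔭A x) ∕ (𝔡A x).Dd` once `h𝔭A` reads `holderProbesKA`.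
[cite: Balaban1985BackgroundPropagators, (3.40) + (3.42) p.397, Thm 3.3 p.399, p.422–423] -/
theorem pX0_of_pins (hG : GeoOK (geo9K i)) {B : B9.Backgrounds} (cfg : B.Cfg → CfgY 𝔸 i) {par : BondParY 𝔸 i} (hpar : par = parBY i) (U₁ : B.Cfg)
    (hU : ∀ μ s, UnitaryLike (cfg U₁ μ s)) {bI : FBondY i → IBondY i}
    (hlev : ∀ x : FBondY i, lvl i.hN i.D i.hk (bI x) = (blkV1 i.hN i.D x).1.1)
    (hβ1 : ∀ x : FBondY i, (geomT i.D).dist (β i.hN i.D i.hk (bI x)) (blkV1 i.hN i.D x) ≤ 1)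
    {𝔭 : B9RWSums343Holder.HolderProbes (geo9K i) B (XBK κ i) (XBK κ i) (PK (FBondY i) (Fin (d + 1)) κ) (PK (FBondY i) (Fin (d + 1)) κ)}
    (h𝔭 : 𝔭 = holderProbesKA i b B cfg par bI) {blk : XBK κ i → IBondY i} (hblk : blk = blkBK i bI)
    {Dd : Fin (d + 1) → ((XBK κ i → ℝ) →ₗ[ℝ] (XBK κ i → ℝ))} (hDd : Dd = fun μ => coordOpK b (fun _ : Fin (d + 1) => cdBₗ i (cfg U₁) μ))
    (hlen : ∀ y : (geo9K i).Site, 0 ≤ (geo9K i).len y)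
    {R₀ : ℝ} {H₀ : Prop} (G0 : (XBK κ i → ℝ) →ₗ[ℝ] (XBK κ i → ℝ)) {B₀ δ₀ : ℝ} (hB₀ : 0 ≤ B₀) (hδ₀ : 0 ≤ δ₀)
    (he0 : HasMajorant (g := toB6 (geo9K i) R₀ H₀) blk G0 (fun a b' => B₀ * (geo9K i).len a ^ 2 * Real.exp (-(δ₀ * (geo9K i).dist a b'))))
    (he1d : ∀ μ : Fin (d + 1), HasMajorantHom (g := toB6 (geo9K i) R₀ H₀) blk blk (Dd μ ∘ₗ G0)
      (fun a b' => B₀ * (geo9K i).len a * Real.exp (-(δ₀ * (geo9K i).dist a b'))))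
    {βh : ℝ} (hβh : βh ≤ 1) :
    HasMaj (cNormR R₀ H₀ blk hlen 0) (cNormR R₀ H₀ 𝔭.blkPX hlen (βh - 2)) (𝔭.ΦX U₁ βh ∘ₗ G0)
      (fun a b' => (coordBound39 b * ((d : ℝ) + 1) * basisBound39 b * B₀ * ((ℓ : ℝ) + 1) * Real.exp (δ₀ * (((d : ℝ) + 1) * (((ℓ : ℝ) + 1) + 1) + 2)) +
        B₀ + coordBound39 b * basisBound39 b * B₀) * Real.exp (-(δ₀ * (geo9K i).dist a b'))) := by
  subst h𝔭 hblk hDd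
  exact pX0_holderProbesKA i b hG cfg hpar U₁ hU hlev hβ1 G0 hB₀ hδ₀ he0 he1d hβh

end

end Literature.MathematicalPhysics.QuantumFieldTheory.Balaban1983to89.B9Thm33G0ProbeZeroAtCutPins
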